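import Literature.MathematicalPhysics.QuantumFieldTheory.Balaban1983to89.B12NodeKnitIndAPlug
import Literature.MathematicalPhysics.QuantumFieldTheory.Balaban1983to89.Node00.Record9

/-!
# NODE N09 · [Balaban1987RG1] AT THE STAGE-9 RECORD `Node00.IsRecordOfRecord₉C` — the Theorem-3 member and the node by name, the ₉ twin of
# `B12NodeKnitRecord8` as a THREE-LINE instantiation of the stage-free plug `B12NodeKnitIndAPlug` at `Node00.flow_datumOfRecord₉` ∕ `indAss_stage9_iff`

T. Bałaban, *Renormalization group approach to lattice gauge field theories. I*, Commun. Math. Phys. **109** (1987) 249–301 [Balaban1987RG1] (= [I]);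
[Balaban1985Variational] (= [B11]) Thm 1 p. 279.  TRACK A (YM-PLAN §2b, node N09 of 28), seat `pub-ymgap-dag-n09-a` (prover, KNIT-BY-NAME; HUMAN RULING D-0062;
the seat's (o1) duty on `Node00.Record9`, seat node00-def-T).  THEOREMS ONLY, def-free, sorry-free, standard axioms.

THE STAGE-9 RECORD (`Node00.Record9`, landed 2026-08-26): the datum is the REPRESENTED tower (explicit densities `densOfRecord₉`, explicit transport, induced `R`),
built under DISPLAYED analytic provisos `h : θ.Provisos`; its construction's flow is `genFlow (betaOfRecord₉ θ) p.g₀` (`flow_datumOfRecord₉`, `rfl`;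
`betaOfRecord₉ θ = betaOfRecord₈ θ.toStage8Params`) and its inductive-assumption clause is node00-def-B's `IndAOfRecord` read at the generated history and the
record's objects — Stage 8's reading VERBATIM at `θ.toStage8Params` (`indAss_stage9_iff`, `Iff.rfl`).  So the Theorem-3 member of N09 at Stage 9 is the stage-free
plug (`B12NodeKnitIndAPlug` §2, facts (F) + (I)) instantiated; `₉C ↛ ₈C` at the datum (LOCATED COST 2 of the INTENT), so the record-level forms are re-keyed here to
`IsRecordOfRecord₉C` (binders over the presenting Stage-9 parameters AND their provisos).

## WHAT THIS FILE PROVES (0 sorry; axioms {propext, Classical.choice, Quot.sound})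
* §1 θ-EXPLICIT (world bound to `(datumOfRecord₉ θ h).C`): `indAss_stage9_iff_stage8` (the Stage-9 clause IS the Stage-8 clause at `θ.toStage8Params`, `Iff.rfl` both
  ways), `thm3Member_stage9_of_hCompT` ∕ `_of_hRestrict` ∕ `_of_middle` (member from (1.1) on `domAltOfRecord` + `HCompT` ∕ + `HRestrict`, intermediate uniqueness,
  orbit-point invariance ∕ middle clauses only), `indAss_stage9_zero` (first step, window `θ.ν.ε₀ ≤ θ.εbg`), `b12_main_stage9_of_leaf_of_hCompT`, `b12_main_stage9_iff_leaf_of_hCompT` (N09 ⇔ «b4 → … → b11 → b12»).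
* §2 AT `IsRecordOfRecord₉C F N D w`: `thm3Member_at_record₉C_of_hCompT` ∕ `_of_hRestrict`, **`b12_main_at_record₉C_iff_leaf`**, `b12_leaf_at_record₉C_iff`,
  **`b12_main_at_record₉C_of_leaf`** (the `h09`-binder shape for N24 at ₉C).
CENSUS OF N09 AT ₉ (kernel): identical to Stage 8 — member ⇐ (c) [B11] Thm 1 at the record's level domains + (d) the composition clauses (middle clauses for K ≥ 3
are point values of the RN-version transport `TOfRecord`: displayed); conjunct 1 = the B12-group pin over the free `Residual₅.X`.  The fine-currency slot
(`Node00.IndAFineRT`, def-B p419415), under which (d) disappears and `b11` feeds the member (`B12NodeKnitIndAPlug` §5–§6), is NOT the slot Record9 binds — available to a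
later record by the same three lines (`thm3Member_of_indAFinePlug`).
HONEST FRAMING: count-neutral kernel bookkeeping; N09 NOT discharged; the provisos `h` of the Stage-9 datum, (1.1), the composition clauses and the pin are binders;
nothing of Bałaban's asserted; one finite four-torus programme at fixed ε — NOT ℝ⁴, NOT infinite volume, NOT OS axioms, NOT a mass gap, NOT the Clay problem.
-/

noncomputable section

namespace Literature.MathematicalPhysics.QuantumFieldTheory.Balaban1983to89.B12NodeKnitRecord9

open DagBinding Node00 T4Continuum
open FlowStep (HBeta prefixOf RGEqH)
open FlowStepRuns (genSeq genFlow)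
open T4FlagMemory (extd)
open B12NodeKnitRecord8 (chi7_extd_prefixOf b12_main_of_leaf_of_thm3Member b12_main_iff_leaf_of_thm3Member indAss_stage8_zero)
open B12NodeKnitIndAPlug (thm3Member_of_indAPlug_of_hCompT thm3Member_of_indAPlug_of_hRestrict thm3Member_of_indAPlug_of_middle)

variable (F : T4Family) (N : ℕ) [NeZero N]

/-! ## §1. θ-explicit: a world bound to the Stage-9 construction `(datumOfRecord₉ θ h).C` -/

/-- **The Stage-9 inductive-assumption clause IS the Stage-8 clause at `θ.toStage8Params`** (both are node00-def-B's `IndAOfRecord` at the same objects; `Iff.rfl` ∘ `Iff.rfl`).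
[cite: Balaban1987RG1, (1.1)–(1.6) pp.260–261 and Thm 3 p.264 (bookkeeping)] -/
theorem indAss_stage9_iff_stage8 (θ : Stage9Params F N) (h : θ.Provisos) (p : B12.RunParams) (k : ℕ) :
    ((datumOfRecord₉ F N θ h).C p).IndAss k ↔ ((datumOfRecord₅ F N (θ.toStage8Params.toStage5 F N)).C p).IndAss k :=
  (indAss_stage9_iff F N θ h p k).trans (indAss_stage8_iff F N θ.toStage8Params p k).symm

/-- **THE FIRST STEP AT THE STAGE-9 CONSTRUCTION** modulo the numeric window `θ.ν.ε₀ ≤ θ.εbg` (the Stage-8 theorem `B12NodeKnitRecord8.indAss_stage8_zero`, transferred).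
[cite: Balaban1987RG1, (0.17) p.255 and (1.1)–(1.3) p.260] -/
theorem indAss_stage9_zero (θ : Stage9Params F N) (h : θ.Provisos) (hε : θ.ν.ε₀ ≤ θ.εbg) (p : B12.RunParams) :
    ((datumOfRecord₉ F N θ h).C p).IndAss 0 :=
  (indAss_stage9_iff_stage8 F N θ h p 0).2 (indAss_stage8_zero F N θ.toStage8Params hε p)

section Stage9

variable {F N}
variable (θ : Stage9Params F N) (h : θ.Provisos) {w : WorldP} (hC : w.C = (datumOfRecord₉ F N θ h).C) (P : B12.RunParams)

include hC in
/-- **THE THEOREM-3 MEMBER OF N09 AT `(w, P)` FOR A WORLD BOUND TO THE STAGE-9 CONSTRUCTION, from (1.1) on the domains and `HCompT`** — the plug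
`B12NodeKnitIndAPlug.thm3Member_of_indAPlug_of_hCompT` at (F) `flow_datumOfRecord₉`, (I) `indAss_stage9_iff`, χ-locality `chi7_extd_prefixOf`.
[cite: Balaban1987RG1, Thm 3 p.264, (1.1)–(1.3) p.260 and (0.22)–(0.23) p.256] -/
theorem thm3Member_stage9_of_hCompT
    (h11 : ∀ k, k ≤ P.K → ∀ V ∈ domAltOfRecord F N θ.ν P.K k, UkExists F N P.K k θ.εbg V ∧ UniqueUkOrbit F N P.K k θ.εbg V)
    (hcomp : ∀ k, k ≤ P.K → HCompT F N (TOfRecord F N) (chi7 F N θ.toStage8Params) θ.εbg P.K (genSeq (betaOfRecord₉ F N θ) P.g0) k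
      (domAltOfRecord F N θ.ν P.K k)) :
    (leavesP w P).smallCouplings → (leavesP w P).smallFieldInductive :=
  thm3Member_of_indAPlug_of_hCompT (chi7 F N θ.toStage8Params) θ.εbg (betaOfRecord₉ F N θ) (fun k => domAltOfRecord F N θ.ν P.K k)
    (by rw [hC]; exact flow_datumOfRecord₉ F N θ h P) (fun k _ => by rw [hC]; exact indAss_stage9_iff F N θ h P k)
    (fun k _ => chi7_extd_prefixOf F N θ.toStage8Params P.K k _) h11 hcomp

include hC in
/-- **The member at the Stage-9 construction from (1.1), `HRestrict`, intermediate uniqueness and the orbit-point invariance of `A_j ∘ Ū^j`.**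
[cite: Balaban1987RG1, Thm 3 p.264, (0.21) p.256, (1.1) p.260 and (2.16) p.269; Balaban1985Variational, Thm 1 (8)–(10) p.279] -/
theorem thm3Member_stage9_of_hRestrict
    (h11 : ∀ k, k ≤ P.K → ∀ V ∈ domAltOfRecord F N θ.ν P.K k, UkExists F N P.K k θ.εbg V ∧ UniqueUkOrbit F N P.K k θ.εbg V)
    (hres : ∀ k, k ≤ P.K → HRestrict F N θ.εbg P.K k (domAltOfRecord F N θ.ν P.K k))
    (huniq : ∀ k, k ≤ P.K → ∀ V ∈ domAltOfRecord F N θ.ν P.K k, ∀ j < k,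
      UniqueUkOrbit F N P.K (j + 1) θ.εbg (Averaging.iter (avOfRecord F N P.K) (j + 1) (Uk F N P.K k θ.εbg V)))
    (hinv : ∀ k, k ≤ P.K → ∀ V ∈ domAltOfRecord F N θ.ν P.K k, ∀ j < k, ∀ u : GaugeTransf (F.P P.K) 0 (SU N),
      B12GaugeOrbits021.IsResidual (j + 1) u →
        effActionH F N (chi7 F N θ.toStage8Params) P.K (genSeq (betaOfRecord₉ F N θ) P.g0) j
            (Averaging.iter (avOfRecord F N P.K) j (GaugeField.gaugeAct u (Uk F N P.K k θ.εbg V))) =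
          effActionH F N (chi7 F N θ.toStage8Params) P.K (genSeq (betaOfRecord₉ F N θ) P.g0) j
            (Averaging.iter (avOfRecord F N P.K) j (Uk F N P.K k θ.εbg V))) :
    (leavesP w P).smallCouplings → (leavesP w P).smallFieldInductive :=
  thm3Member_of_indAPlug_of_hRestrict (chi7 F N θ.toStage8Params) θ.εbg (betaOfRecord₉ F N θ) (fun k => domAltOfRecord F N θ.ν P.K k)
    (by rw [hC]; exact flow_datumOfRecord₉ F N θ h P) (fun k _ => by rw [hC]; exact indAss_stage9_iff F N θ h P k)
    (fun k _ => chi7_extd_prefixOf F N θ.toStage8Params P.K k _) h11 hres huniq hinv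

include hC in
/-- **The member at the Stage-9 construction with the invariance input reduced to the middle composition clauses** (top clause automatic, bottom clause = `HOrbit`'s
+ Wilson gauge invariance). [cite: Balaban1987RG1, Thm 3 p.264, (0.21)–(0.23) p.256 and (2.16) p.269] -/
theorem thm3Member_stage9_of_middle
    (h11 : ∀ k, k ≤ P.K → ∀ V ∈ domAltOfRecord F N θ.ν P.K k, UkExists F N P.K k θ.εbg V ∧ UniqueUkOrbit F N P.K k θ.εbg V)
    (hO0 : ∀ k, k ≤ P.K → 1 < k → ∀ V ∈ domAltOfRecord F N θ.ν P.K k,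
      B12GaugeOrbits021.OrbitRel 1 (Uk F N P.K k θ.εbg V) (Uk F N P.K 1 θ.εbg (Averaging.iter (avOfRecord F N P.K) 1 (Uk F N P.K k θ.εbg V))))
    (hmid : ∀ k, k ≤ P.K → ∀ V ∈ domAltOfRecord F N θ.ν P.K k, ∀ j, 1 ≤ j → j + 1 < k →
      effActionH F N (chi7 F N θ.toStage8Params) P.K (genSeq (betaOfRecord₉ F N θ) P.g0) j
          (Averaging.iter (avOfRecord F N P.K) j (Uk F N P.K (j + 1) θ.εbg (Averaging.iter (avOfRecord F N P.K) (j + 1) (Uk F N P.K k θ.εbg V)))) =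
        effActionH F N (chi7 F N θ.toStage8Params) P.K (genSeq (betaOfRecord₉ F N θ) P.g0) j
          (Averaging.iter (avOfRecord F N P.K) j (Uk F N P.K k θ.εbg V))) :
    (leavesP w P).smallCouplings → (leavesP w P).smallFieldInductive :=
  thm3Member_of_indAPlug_of_middle (chi7 F N θ.toStage8Params) θ.εbg (betaOfRecord₉ F N θ) (fun k => domAltOfRecord F N θ.ν P.K k)
    (by rw [hC]; exact flow_datumOfRecord₉ F N θ h P) (fun k _ => by rw [hC]; exact indAss_stage9_iff F N θ h P k)
    (fun k _ => chi7_extd_prefixOf F N θ.toStage8Params P.K k _) h11 hO0 hmid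

include hC in
/-- **N09 AT `(w, P)`, Stage-9 construction, from the own leaf and the [B11]-side inputs (1.1) + `HCompT`.** [cite: Balaban1987RG1, Lemma 4 (3.53) p.280, Thm 3 p.264 and (1.1)–(1.3) p.260] -/
theorem b12_main_stage9_of_leaf_of_hCompT (h12 : (leavesP w P).b12)
    (h11 : ∀ k, k ≤ P.K → ∀ V ∈ domAltOfRecord F N θ.ν P.K k, UkExists F N P.K k θ.εbg V ∧ UniqueUkOrbit F N P.K k θ.εbg V)
    (hcomp : ∀ k, k ≤ P.K → HCompT F N (TOfRecord F N) (chi7 F N θ.toStage8Params) θ.εbg P.K (genSeq (betaOfRecord₉ F N θ) P.g0) k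
      (domAltOfRecord F N θ.ν P.K k)) :
    Dag.B12_main (leavesP w P) :=
  b12_main_of_leaf_of_thm3Member h12 (thm3Member_stage9_of_hCompT θ h hC P h11 hcomp)

include hC in
/-- **N09 AT `(w, P)`, Stage-9 construction, IS «in-edges → its own leaf `b12`»** given the [B11]-side inputs. [cite: Balaban1987RG1, Lemma 4 (3.53) p.280 and Thm 3 p.264] -/
theorem b12_main_stage9_iff_leaf_of_hCompT
    (h11 : ∀ k, k ≤ P.K → ∀ V ∈ domAltOfRecord F N θ.ν P.K k, UkExists F N P.K k θ.εbg V ∧ UniqueUkOrbit F N P.K k θ.εbg V)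
    (hcomp : ∀ k, k ≤ P.K → HCompT F N (TOfRecord F N) (chi7 F N θ.toStage8Params) θ.εbg P.K (genSeq (betaOfRecord₉ F N θ) P.g0) k
      (domAltOfRecord F N θ.ν P.K k)) :
    Dag.B12_main (leavesP w P) ↔
      ((leavesP w P).b4 → (leavesP w P).b5 → (leavesP w P).b6 → (leavesP w P).b7 → (leavesP w P).b8 → (leavesP w P).b9 →
        (leavesP w P).b10 → (leavesP w P).b11 → (leavesP w P).b12) :=
  b12_main_iff_leaf_of_thm3Member (thm3Member_stage9_of_hCompT θ h hC P h11 hcomp)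

end Stage9

/-! ## §2. At the Stage-9 record predicate `IsRecordOfRecord₉C F N D w` (binders over the presenting parameters and their provisos) -/

section Record

variable {F N}
variable {D : FiniteEpsData F (SU N)} {w : WorldP}

/-- **THE THEOREM-3 MEMBER OF N09 AT EVERY RUN OF A STAGE-9 RECORD, from (1.1) on the domains and `HCompT` over the record's presenting parameters.**
[cite: Balaban1987RG1, Thm 1 p.259, Thm 3 p.264, (1.1)–(1.3) p.260 and (0.22)–(0.23) p.256] -/
theorem thm3Member_at_record₉C_of_hCompT (hrec : IsRecordOfRecord₉C F N D w)
    (h11 : ∀ θ : Stage9Params F N, ∀ h : θ.Provisos, θ.Admissible → D = datumOfRecord₉ F N θ h → w.γ ≤ θ.γ →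
      ∀ (p : B12.RunParams) (k : ℕ), k ≤ p.K →
        ∀ V ∈ domAltOfRecord F N θ.ν p.K k, UkExists F N p.K k θ.εbg V ∧ UniqueUkOrbit F N p.K k θ.εbg V)
    (hcomp : ∀ θ : Stage9Params F N, ∀ h : θ.Provisos, θ.Admissible → D = datumOfRecord₉ F N θ h → w.γ ≤ θ.γ →
      ∀ (p : B12.RunParams) (k : ℕ), k ≤ p.K →
        HCompT F N (TOfRecord F N) (chi7 F N θ.toStage8Params) θ.εbg p.K (genSeq (betaOfRecord₉ F N θ) p.g0) k (domAltOfRecord F N θ.ν p.K k))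
    (P : B12.RunParams) : (leavesP w P).smallCouplings → (leavesP w P).smallFieldInductive := by
  obtain ⟨θ, h, hθ, hD, hC, hγ, -, -⟩ := hrec
  have hC' : w.C = (datumOfRecord₉ F N θ h).C := by rw [hC, hD]
  exact thm3Member_stage9_of_hCompT θ h hC' P (fun k hk => h11 θ h hθ hD hγ.2 P k hk) (fun k hk => hcomp θ h hθ hD hγ.2 P k hk)

/-- **The member at a Stage-9 record from (1.1), `HRestrict`, intermediate uniqueness and the orbit-point invariance over the record's presenting parameters.**
[cite: Balaban1987RG1, Thm 3 p.264, (0.21) p.256, (1.1) p.260, (2.16) p.269; Balaban1985Variational, Thm 1 (8)–(10) p.279] -/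
theorem thm3Member_at_record₉C_of_hRestrict (hrec : IsRecordOfRecord₉C F N D w)
    (h11 : ∀ θ : Stage9Params F N, ∀ h : θ.Provisos, θ.Admissible → D = datumOfRecord₉ F N θ h → w.γ ≤ θ.γ →
      ∀ (p : B12.RunParams) (k : ℕ), k ≤ p.K →
        ∀ V ∈ domAltOfRecord F N θ.ν p.K k, UkExists F N p.K k θ.εbg V ∧ UniqueUkOrbit F N p.K k θ.εbg V)
    (hres : ∀ θ : Stage9Params F N, ∀ h : θ.Provisos, θ.Admissible → D = datumOfRecord₉ F N θ h → w.γ ≤ θ.γ →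
      ∀ (p : B12.RunParams) (k : ℕ), k ≤ p.K → HRestrict F N θ.εbg p.K k (domAltOfRecord F N θ.ν p.K k))
    (huniq : ∀ θ : Stage9Params F N, ∀ h : θ.Provisos, θ.Admissible → D = datumOfRecord₉ F N θ h → w.γ ≤ θ.γ →
      ∀ (p : B12.RunParams) (k : ℕ), k ≤ p.K → ∀ V ∈ domAltOfRecord F N θ.ν p.K k, ∀ j < k,
        UniqueUkOrbit F N p.K (j + 1) θ.εbg (Averaging.iter (avOfRecord F N p.K) (j + 1) (Uk F N p.K k θ.εbg V)))
    (hinv : ∀ θ : Stage9Params F N, ∀ h : θ.Provisos, θ.Admissible → D = datumOfRecord₉ F N θ h → w.γ ≤ θ.γ →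
      ∀ (p : B12.RunParams) (k : ℕ), k ≤ p.K → ∀ V ∈ domAltOfRecord F N θ.ν p.K k, ∀ j < k,
        ∀ u : GaugeTransf (F.P p.K) 0 (SU N), B12GaugeOrbits021.IsResidual (j + 1) u →
          effActionH F N (chi7 F N θ.toStage8Params) p.K (genSeq (betaOfRecord₉ F N θ) p.g0) j
              (Averaging.iter (avOfRecord F N p.K) j (GaugeField.gaugeAct u (Uk F N p.K k θ.εbg V))) =
            effActionH F N (chi7 F N θ.toStage8Params) p.K (genSeq (betaOfRecord₉ F N θ) p.g0) j
              (Averaging.iter (avOfRecord F N p.K) j (Uk F N p.K k θ.εbg V)))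
    (P : B12.RunParams) : (leavesP w P).smallCouplings → (leavesP w P).smallFieldInductive := by
  obtain ⟨θ, h, hθ, hD, hC, hγ, -, -⟩ := hrec
  have hC' : w.C = (datumOfRecord₉ F N θ h).C := by rw [hC, hD]
  exact thm3Member_stage9_of_hRestrict θ h hC' P (fun k hk => h11 θ h hθ hD hγ.2 P k hk) (fun k hk => hres θ h hθ hD hγ.2 P k hk)
    (fun k hk => huniq θ h hθ hD hγ.2 P k hk) (fun k hk => hinv θ h hθ hD hγ.2 P k hk)

/-- **N09 AT A STAGE-9 RECORD IS ITS OWN LEAF** (given the [B11]-side inputs over the record's presenting parameters): `Dag.B12_main (leavesP w P)` ↔ «`b4 → … →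
b11 → b12`». [cite: Balaban1987RG1, Lemma 4 (3.53) p.280, Thm 1 p.259 and Thm 3 p.264] -/
theorem b12_main_at_record₉C_iff_leaf (hrec : IsRecordOfRecord₉C F N D w)
    (h11 : ∀ θ : Stage9Params F N, ∀ h : θ.Provisos, θ.Admissible → D = datumOfRecord₉ F N θ h → w.γ ≤ θ.γ →
      ∀ (p : B12.RunParams) (k : ℕ), k ≤ p.K →
        ∀ V ∈ domAltOfRecord F N θ.ν p.K k, UkExists F N p.K k θ.εbg V ∧ UniqueUkOrbit F N p.K k θ.εbg V)
    (hcomp : ∀ θ : Stage9Params F N, ∀ h : θ.Provisos, θ.Admissible → D = datumOfRecord₉ F N θ h → w.γ ≤ θ.γ →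
      ∀ (p : B12.RunParams) (k : ℕ), k ≤ p.K →
        HCompT F N (TOfRecord F N) (chi7 F N θ.toStage8Params) θ.εbg p.K (genSeq (betaOfRecord₉ F N θ) p.g0) k (domAltOfRecord F N θ.ν p.K k))
    (P : B12.RunParams) :
    Dag.B12_main (leavesP w P) ↔
      ((leavesP w P).b4 → (leavesP w P).b5 → (leavesP w P).b6 → (leavesP w P).b7 → (leavesP w P).b8 → (leavesP w P).b9 →
        (leavesP w P).b10 → (leavesP w P).b11 → (leavesP w P).b12) :=
  b12_main_iff_leaf_of_thm3Member (thm3Member_at_record₉C_of_hCompT hrec h11 hcomp P)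

/-- **THE OWN LEAF AT A STAGE-9 RECORD, UNFOLDED** over the presenting parameters: `(leavesP w P).b12 ↔ B12Sec2to5.Lemma4Printed (θ.res.X P).F12 (θ.res.X P).c12` —
Lemma 4 over the record's FREE run-indexed B12 carriers (the B12-group pin NODE 00 owes, unchanged at Stage 9). [cite: Balaban1987RG1, Lemma 4 (3.53) p.280 (bookkeeping)] -/
theorem b12_leaf_at_record₉C_iff (hrec : IsRecordOfRecord₉C F N D w) (P : B12.RunParams) :
    ∃ (θ : Stage9Params F N) (h : θ.Provisos), θ.Admissible ∧ D = datumOfRecord₉ F N θ h ∧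
      (∀ P', w.up P' = upOfRecord₅C F N (θ.toStage5 F N) P') ∧
        ((leavesP w P).b12 ↔ B12Sec2to5.Lemma4Printed (θ.res.X P).F12 (θ.res.X P).c12) := by
  obtain ⟨θ, h, hθ, hD, -, -, -, hup⟩ := hrec
  refine ⟨θ, h, hθ, hD, hup, ?_⟩
  show (w.up P).b12 ↔ _
  rw [hup P]
  exact Iff.rfl

/-- **N09 AT EVERY RUN OF A STAGE-9 RECORD from the B12-group pin slot + (1.1) + `HCompT` over the record's presenting parameters** — the `h09`-binder shape for
N24's knit at ₉C (cf. `B12NodeKnitRecord8.b12_main_at_record₈C_of_leaf`). [cite: Balaban1987RG1, Lemma 4 (3.53) p.280, Thm 1 p.259 and Thm 3 p.264] -/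
theorem b12_main_at_record₉C_of_leaf (hrec : IsRecordOfRecord₉C F N D w)
    (hb12 : ∀ θ : Stage9Params F N, ∀ h : θ.Provisos, θ.Admissible → D = datumOfRecord₉ F N θ h → w.γ ≤ θ.γ →
      (∀ P, w.up P = upOfRecord₅C F N (θ.toStage5 F N) P) → ∀ P, B12Sec2to5.Lemma4Printed (θ.res.X P).F12 (θ.res.X P).c12)
    (h11 : ∀ θ : Stage9Params F N, ∀ h : θ.Provisos, θ.Admissible → D = datumOfRecord₉ F N θ h → w.γ ≤ θ.γ →
      ∀ (p : B12.RunParams) (k : ℕ), k ≤ p.K →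
        ∀ V ∈ domAltOfRecord F N θ.ν p.K k, UkExists F N p.K k θ.εbg V ∧ UniqueUkOrbit F N p.K k θ.εbg V)
    (hcomp : ∀ θ : Stage9Params F N, ∀ h : θ.Provisos, θ.Admissible → D = datumOfRecord₉ F N θ h → w.γ ≤ θ.γ →
      ∀ (p : B12.RunParams) (k : ℕ), k ≤ p.K →
        HCompT F N (TOfRecord F N) (chi7 F N θ.toStage8Params) θ.εbg p.K (genSeq (betaOfRecord₉ F N θ) p.g0) k (domAltOfRecord F N θ.ν p.K k))
    (P : B12.RunParams) : Dag.B12_main (leavesP w P) := by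
  obtain ⟨θ, h, hθ, hD, hC, hγ, -, hup⟩ := id hrec
  have h12 : (leavesP w P).b12 := by
    show (w.up P).b12
    rw [hup P]
    exact hb12 θ h hθ hD hγ.2 hup P
  exact b12_main_of_leaf_of_thm3Member h12 (thm3Member_at_record₉C_of_hCompT hrec h11 hcomp P)

end Record

end Literature.MathematicalPhysics.QuantumFieldTheory.Balaban1983to89.B12NodeKnitRecord9

end
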